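import Summits.Ventures.LatticeQCDFlow.Scoring.SU2TorusPlaquetteCharacterIntegral
import HarnessLib

/-!
# SU(2) on the 2-torus: the Haar integral of a product of plaquette characters WITH TWO DISTINCT PLAQUETTE TRACES INSERTED

HONEST FRAMING: exact (Metropolis-corrected) sampling algorithms for lattice gauge theory;
figures of merit are autocorrelation/cost numbers at stated couplings and volumes; no
continuum-physics claim.

Venture `LatticeQCDFlow` (cell pub-lqcd), sub-topic `Scoring`; FANOUT row 5 (`s0-sun-a`), GEN-12.
NEW WORK of the cell (placement rule); towards the EXACT PAIR CORRELATION `⟨½ tr U_p · ½ tr U_q⟩_{(ℤ/L)²,β}`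
of two distinct plaquettes (the covariance term of the error-bar oracle `Var(P̄)`).  GEN-10's insertion rule
`a₀·χ_k = ½(χ_{k+1} + χ_{k−1})` applied at two different plaquettes `x₀ ≠ y₀`:

* `su2a0_mul_su2a0_mul_prod_su2Character` — pointwise,
  `a₀(U_{x₀})·(a₀(U_{y₀})·∏_x χ_{m_x}(U_x)) = ½ a₀(U_{x₀})∏ χ_{m^{+y}} + ½[m_{y₀} ≠ 0] a₀(U_{x₀})∏ χ_{m^{−y}}`;
* **`integral_su2a0_mul_su2a0_mul_prod_su2Character_plaquettes`** — for `x₀ ≠ y₀`,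
  `∫ a₀(U_{x₀}) a₀(U_{y₀}) ∏_x χ_{m_x}(U_x) dHaar^{⊗E}
   = ¼ I(m^{+y+x}) + ¼[m_{x₀} ≠ 0] I(m^{+y−x}) + ¼[m_{y₀} ≠ 0] I(m^{−y+x}) + ¼[m_{y₀} ≠ 0][m_{x₀} ≠ 0] I(m^{−y−x})`,
  `I(m') = [m' constant]·((m'_0+1)^{L²})⁻¹`, `m^{±y±x} = update (update m y₀ (m_{y₀} ± 1)) x₀ (m_{x₀} ± 1)`.

Elementary; nothing is cited; no `def`.
-/

noncomputable section

open Real MeasureTheory Set Function Finset Polynomial.Chebyshev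
open Literature.MathematicalPhysics.QuantumFieldTheory Literature.MathematicalPhysics.QuantumLattice
open Summit.Ventures.LatticeQCDFlow.Exactness

namespace Summit.Ventures.LatticeQCDFlow.Scoring

variable {L : ℕ} [NeZero L]

/-! ## §1. Two insertions at distinct plaquettes: pointwise -/

/-- **Inserting a second plaquette trace**, pointwise: with `m^{±y} = update m y₀ (m_{y₀} ± 1)`,
`a₀(U_{x₀})·(a₀(U_{y₀})·∏_x χ_{m_x}(U_x)) = ½·a₀(U_{x₀})∏_x χ_{m^{+y}_x}(U_x) + ½·[m_{y₀} ≠ 0]·a₀(U_{x₀})∏_x χ_{m^{−y}_x}(U_x)`. -/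
theorem su2a0_mul_su2a0_mul_prod_su2Character {Ω : Type*} (t : Site 2 L → Ω → ℝ) (m : Site 2 L → ℕ)
    (x₀ y₀ : Site 2 L) (V : Ω) :
    t x₀ V * (t y₀ V * ∏ x : Site 2 L, (U ℝ (m x)).eval (t x V)) =
      (1 / 2) * (t x₀ V * ∏ x : Site 2 L, (U ℝ (update m y₀ (m y₀ + 1) x)).eval (t x V)) +
        (1 / 2) * (if m y₀ = 0 then 0 else
          t x₀ V * ∏ x : Site 2 L, (U ℝ (update m y₀ (m y₀ - 1) x)).eval (t x V)) := by
  rw [su2a0_mul_prod_su2Character t m y₀ V]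
  split_ifs <;> ring

/-! ## §2. The doubly-inserted character integral on the torus -/

/-- **THE DOUBLY-INSERTED CHARACTER INTEGRAL ON THE 2-TORUS.**  For `L ≥ 1`, `m : Λ → ℕ`, two DISTINCT
plaquettes `x₀ ≠ y₀` and product Haar measure on the links of `(ℤ/L)²`:
`∫ a₀(U_{x₀}) a₀(U_{y₀}) ∏_x χ_{m_x}(U_x) dHaar^{⊗E}
 = ¼ I(m^{+y+x}) + ¼[m_{x₀} ≠ 0] I(m^{+y−x}) + ¼[m_{y₀} ≠ 0] (I(m^{−y+x}) + [m_{x₀} ≠ 0] I(m^{−y−x}))`,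
`I(m') = [∀ x, m'_x = m'_0]·((m'_0+1)^{L²})⁻¹`, `m^{±y±x} = update (update m y₀ (m_{y₀} ± 1)) x₀ (m_{x₀} ± 1)`. -/
theorem integral_su2a0_mul_su2a0_mul_prod_su2Character_plaquettes (m : Site 2 L → ℕ) {x₀ y₀ : Site 2 L}
    (hxy : x₀ ≠ y₀) :
    ∫ V, su2a0 (plaquetteHolonomy V x₀ 0 1) * (su2a0 (plaquetteHolonomy V y₀ 0 1) *
        ∏ x : Site 2 L, (U ℝ (m x)).eval (su2a0 (plaquetteHolonomy V x 0 1)))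
        ∂(Measure.pi fun _ : Edge 2 L => haarProbability (Matrix.specialUnitaryGroup (Fin 2) ℂ)) =
      (1 / 4) * (if (∀ x, update (update m y₀ (m y₀ + 1)) x₀ (m x₀ + 1) x =
            update (update m y₀ (m y₀ + 1)) x₀ (m x₀ + 1) 0) then
          ((((update (update m y₀ (m y₀ + 1)) x₀ (m x₀ + 1) 0 : ℝ) + 1) ^ (L ^ 2)))⁻¹ else 0) +
        (1 / 4) * (if m x₀ = 0 then 0 else
          if (∀ x, update (update m y₀ (m y₀ + 1)) x₀ (m x₀ - 1) x =
              update (update m y₀ (m y₀ + 1)) x₀ (m x₀ - 1) 0) then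
            ((((update (update m y₀ (m y₀ + 1)) x₀ (m x₀ - 1) 0 : ℝ) + 1) ^ (L ^ 2)))⁻¹ else 0) +
        (1 / 4) * (if m y₀ = 0 then 0 else
          ((if (∀ x, update (update m y₀ (m y₀ - 1)) x₀ (m x₀ + 1) x =
              update (update m y₀ (m y₀ - 1)) x₀ (m x₀ + 1) 0) then
            ((((update (update m y₀ (m y₀ - 1)) x₀ (m x₀ + 1) 0 : ℝ) + 1) ^ (L ^ 2)))⁻¹ else 0) +
          (if m x₀ = 0 then 0 else
            if (∀ x, update (update m y₀ (m y₀ - 1)) x₀ (m x₀ - 1) x =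
                update (update m y₀ (m y₀ - 1)) x₀ (m x₀ - 1) 0) then
              ((((update (update m y₀ (m y₀ - 1)) x₀ (m x₀ - 1) 0 : ℝ) + 1) ^ (L ^ 2)))⁻¹ else 0))) := by
  simp_rw [su2a0_mul_su2a0_mul_prod_su2Character (fun (x : Site 2 L)
    (V : GaugeConfig 2 L (Matrix.specialUnitaryGroup (Fin 2) ℂ)) => su2a0 (plaquetteHolonomy V x 0 1)) m x₀ y₀]
  have hi1 : Integrable (fun V : GaugeConfig 2 L (Matrix.specialUnitaryGroup (Fin 2) ℂ) =>
      su2a0 (plaquetteHolonomy V x₀ 0 1) *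
        ∏ x : Site 2 L, (U ℝ (update m y₀ (m y₀ + 1) x)).eval (su2a0 (plaquetteHolonomy V x 0 1)))
      (Measure.pi fun _ : Edge 2 L => haarProbability (Matrix.specialUnitaryGroup (Fin 2) ℂ)) := by
    refine integrable_pi_su2_of_continuous (ι := Edge 2 L) ?_
    refine Continuous.mul ?_ (continuous_prod_su2Character_plaquettes (update m y₀ (m y₀ + 1)))
    exact continuous_su2a0.comp (by unfold plaquetteHolonomy; fun_prop)
  have hx1 : update m y₀ (m y₀ + 1) x₀ = m x₀ := update_of_ne hxy _ _
  have hx2 : update m y₀ (m y₀ - 1) x₀ = m x₀ := update_of_ne hxy _ _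
  by_cases h0 : m y₀ = 0
  · simp_rw [if_pos h0, mul_zero, add_zero]
    rw [integral_const_mul,
      integral_su2a0_mul_prod_su2Character_plaquettes (update m y₀ (m y₀ + 1)) x₀, hx1]
    ring
  · simp_rw [if_neg h0]
    have hi2 : Integrable (fun V : GaugeConfig 2 L (Matrix.specialUnitaryGroup (Fin 2) ℂ) =>
        su2a0 (plaquetteHolonomy V x₀ 0 1) *
          ∏ x : Site 2 L, (U ℝ (update m y₀ (m y₀ - 1) x)).eval (su2a0 (plaquetteHolonomy V x 0 1)))
        (Measure.pi fun _ : Edge 2 L => haarProbability (Matrix.specialUnitaryGroup (Fin 2) ℂ)) := by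
      refine integrable_pi_su2_of_continuous (ι := Edge 2 L) ?_
      refine Continuous.mul ?_ (continuous_prod_su2Character_plaquettes (update m y₀ (m y₀ - 1)))
      exact continuous_su2a0.comp (by unfold plaquetteHolonomy; fun_prop)
    rw [integral_add (hi1.const_mul _) (hi2.const_mul _), integral_const_mul, integral_const_mul,
      integral_su2a0_mul_prod_su2Character_plaquettes (update m y₀ (m y₀ + 1)) x₀,
      integral_su2a0_mul_prod_su2Character_plaquettes (update m y₀ (m y₀ - 1)) x₀, hx1, hx2]
    ring

end Summit.Ventures.LatticeQCDFlow.Scoring
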